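import Mathlib

/-!
# Negative lemma for crux `VerticalSelmerBound` (stmt-BirchSwinnertonDyer-18432): the typed weight clause admits off-branch weights at every depth

Small-model facts about the load-bearing weight hypothesis `2 * (p - 1) * p ^ N ∣ k - 2 ∧ 2 * hK ∣ k - 2` of
`Summit.BirchSwinnertonDyer.BirchSwinnertonDyer.Theses.VerticalContact.VerticalSelmerBound` (shared verbatim by
its sister crux `VerticalContact`). The intended trivial-character Gross period needs the BRANCH clause
`2 * (p - 1) * p ^ N * hK ∣ k - 2` (the toric character `c ↦ α_c ^ ((k-2)/hK)` is `≡ 1 (mod 𝔓^(N+1))` iff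
`(p-1)·p^N ∣ (k-2)/hK`). We certify exactly when the typed clause is weaker:

* `branchClause_of_coprime` — if `hK` is coprime to `2(p-1)p^N` the typed clause implies the branch clause
  (the off-branch artefact of the rev-1 typing is then vacuous);
* `weightClause_offBranch` — if some `d > 1` divides both `hK` and `p - 1` then at EVERY depth `N` the weight
  `k = 2 + 2(p-1)p^N·(hK/d)` satisfies the typed clause and misses the branch clause;
* `toricExponent_dvd_iff` / `weightClause_offCharacter` — the EXACT triviality criterion is
  `(p-1)p^N ∣ (k-2)/hK ↔ (p-1)p^N·hK ∣ k-2` (no factor `2`: for even `hK` the branch clause is sufficient but not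
  necessary), and if some `d > 2` divides both `hK` and `p - 1` then at every depth the same weight even misses
  `(p-1)p^N·hK ∣ k-2`, i.e. the toric character `α_c^((k-2)/hK)` is NOT `≡ 1 (mod 𝔓^(N+1))` for a class `c` whose
  `α_c` is a primitive root mod a prime of `K` above `p` — the typed crux then quantifies over periods twisted by a
  non-trivial class-group character at every depth (for `d = 2` only, the character is still trivial);
* `weightClause_offBranch_thirteen_three` — the recorded instance `p = 13`, `hK = 3` (`K = ℚ(√-23)`), and
  `offBranchCharacter_sqrtNeg23_thirteen` — there the off-branch toric character is a NON-trivial cubic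
  class-group character: `α = (3+√-23)/2` generates `𝔞³` with `𝔞 ∣ 2` non-principal (`no_norm_two_sqrtNeg23`) and
  `α^((13-1)/3) ≢ 1` at both primes above `13` (refuter R2; analytic half `L(37a1/K, χ₀, 1) ≠ 0` is PARI job
  j022972 on the item).

Refuter cdisprove seat, 2026-08-17; `--supports stmt-BirchSwinnertonDyer-18432`; no Theses statement is asserted.
-/

namespace Summit.BirchSwinnertonDyer.BirchSwinnertonDyer.Theorems.VerticalSelmerBound.Negative

set_option linter.dupNamespace false

/-- When `hK` is coprime to `2(p-1)p^N`, the typed weight clause of `VerticalSelmerBound` already implies the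
branch clause `2(p-1)p^N·hK ∣ k-2` (so the off-branch artefact is vacuous, e.g. whenever `gcd(hK, 2(p-1)) = 1`;
`p ∤ hK` is a hypothesis of the crux). -/
theorem branchClause_of_coprime {p N hK k : ℕ} (hcop : Nat.Coprime (2 * (p - 1) * p ^ N) hK)
    (h1 : 2 * (p - 1) * p ^ N ∣ k - 2) (h2 : 2 * hK ∣ k - 2) : 2 * (p - 1) * p ^ N * hK ∣ k - 2 :=
  hcop.mul_dvd_of_dvd_of_dvd h1 ((dvd_mul_left hK 2).trans h2)

/-- **Off-branch weights at every depth.** If `d > 1` divides both `hK > 0` and `p - 1` (i.e. `gcd(hK, p-1) > 1`,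
`2 ≤ p`), then for every depth `N` the weight `k := 2 + 2(p-1)p^N·(hK/d)` satisfies the typed clause
`2 < k ∧ 2(p-1)p^N ∣ k-2 ∧ 2hK ∣ k-2` but NOT the branch clause `2(p-1)p^N·hK ∣ k-2`. -/
theorem weightClause_offBranch {p hK d : ℕ} (hp : 2 ≤ p) (hK0 : 0 < hK) (hd : 1 < d) (hdh : d ∣ hK)
    (hdp : d ∣ p - 1) (N : ℕ) :
    ∃ k : ℕ, 2 < k ∧ 2 * (p - 1) * p ^ N ∣ k - 2 ∧ 2 * hK ∣ k - 2 ∧ ¬ 2 * (p - 1) * p ^ N * hK ∣ k - 2 := by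
  obtain ⟨a, rfl⟩ := hdh
  obtain ⟨b, hb⟩ := hdp
  have ha0 : 0 < a := Nat.pos_of_ne_zero fun h => by simp [h] at hK0
  have hpN : 0 < p ^ N := pow_pos (by omega) N
  have hp1 : 0 < p - 1 := by omega
  have hM : 0 < 2 * (p - 1) * p ^ N * a := Nat.mul_pos (Nat.mul_pos (Nat.mul_pos two_pos hp1) hpN) ha0
  refine ⟨2 + 2 * (p - 1) * p ^ N * a, Nat.lt_add_of_pos_right hM, ?_, ?_, ?_⟩
  · rw [Nat.add_sub_cancel_left]
    exact dvd_mul_right _ _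
  · rw [Nat.add_sub_cancel_left, hb]
    exact ⟨b * p ^ N, by ring⟩
  · rw [Nat.add_sub_cancel_left]
    intro h
    have hle := Nat.le_of_dvd hM h
    have hmul : 2 * (p - 1) * p ^ N * a * d ≤ 2 * (p - 1) * p ^ N * a * 1 := by
      calc 2 * (p - 1) * p ^ N * a * d = 2 * (p - 1) * p ^ N * (d * a) := by ring
        _ ≤ 2 * (p - 1) * p ^ N * a := hle
        _ = 2 * (p - 1) * p ^ N * a * 1 := (mul_one _).symm
    have := Nat.le_of_mul_le_mul_left hmul hM
    omega

/-- Exact bookkeeping of the toric exponent: for `0 < hK ∣ k - 2`,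
`(p-1)p^N ∣ (k-2)/hK ↔ (p-1)p^N·hK ∣ k-2`. (The character `c ↦ α_c^((k-2)/hK)` is `≡ 1 mod 𝔓^(N+1)` for every
choice of generators iff the left side holds, `(𝓞_K/𝔭^(N+1))ˣ` being cyclic of order `(p-1)p^N` for `p` split.) -/
theorem toricExponent_dvd_iff {p N hK k : ℕ} (hK0 : 0 < hK) (hdvd : hK ∣ k - 2) :
    (p - 1) * p ^ N ∣ (k - 2) / hK ↔ (p - 1) * p ^ N * hK ∣ k - 2 := by
  obtain ⟨m, hm⟩ := hdvd
  rw [hm, Nat.mul_div_cancel_left m hK0, mul_comm ((p - 1) * p ^ N) hK]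
  exact (Nat.mul_dvd_mul_iff_left hK0).symm

/-- **Off-character weights at every depth.** If some `d > 2` divides both `hK > 0` and `p - 1`, then for every
depth `N` the typed-admissible weight `k := 2 + 2(p-1)p^N·(hK/d)` misses even `(p-1)p^N·hK ∣ k-2`, so (by
`toricExponent_dvd_iff`) `(p-1)p^N ∤ (k-2)/hK`: the toric character is non-trivial mod `𝔓^(N+1)` on any class whose
generator `α_c` is a primitive root modulo a prime of `K` above `p`. -/
theorem weightClause_offCharacter {p hK d : ℕ} (hp : 2 ≤ p) (hK0 : 0 < hK) (hd : 2 < d) (hdh : d ∣ hK)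
    (hdp : d ∣ p - 1) (N : ℕ) :
    ∃ k : ℕ, 2 < k ∧ 2 * (p - 1) * p ^ N ∣ k - 2 ∧ 2 * hK ∣ k - 2 ∧ ¬ (p - 1) * p ^ N * hK ∣ k - 2 := by
  obtain ⟨a, rfl⟩ := hdh
  obtain ⟨b, hb⟩ := hdp
  have ha0 : 0 < a := Nat.pos_of_ne_zero fun h => by simp [h] at hK0
  have hpN : 0 < p ^ N := pow_pos (by omega) N
  have hp1 : 0 < p - 1 := by omega
  have hM : 0 < (p - 1) * p ^ N * a := Nat.mul_pos (Nat.mul_pos hp1 hpN) ha0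
  have hM2 : 0 < 2 * (p - 1) * p ^ N * a := by
    have := Nat.mul_pos two_pos hM
    simpa [mul_assoc] using this
  refine ⟨2 + 2 * (p - 1) * p ^ N * a, Nat.lt_add_of_pos_right hM2, ?_, ?_, ?_⟩
  · rw [Nat.add_sub_cancel_left]
    exact dvd_mul_right _ _
  · rw [Nat.add_sub_cancel_left, hb]
    exact ⟨b * p ^ N, by ring⟩
  · rw [Nat.add_sub_cancel_left]
    intro h
    have hle := Nat.le_of_dvd hM2 h
    have hmul : (p - 1) * p ^ N * a * d ≤ (p - 1) * p ^ N * a * 2 := by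
      calc (p - 1) * p ^ N * a * d = (p - 1) * p ^ N * (d * a) := by ring
        _ ≤ 2 * (p - 1) * p ^ N * a := hle
        _ = (p - 1) * p ^ N * a * 2 := by ring
    have := Nat.le_of_mul_le_mul_left hmul hM
    omega

/-- The recorded instance of R2: `p = 13` (good ordinary for `37a1`, split in `ℚ(√-23)`), `hK = h(-23) = 3`,
`d = gcd(3, 12) = 3`: off-branch typed-admissible weights `k = 2 + 24·13^N` exist at every depth `N`. -/
theorem weightClause_offBranch_thirteen_three (N : ℕ) :
    ∃ k : ℕ, 2 < k ∧ 2 * (13 - 1) * 13 ^ N ∣ k - 2 ∧ 2 * 3 ∣ k - 2 ∧ ¬ 2 * (13 - 1) * 13 ^ N * 3 ∣ k - 2 :=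
  weightClause_offBranch (p := 13) (hK := 3) (d := 3) (by norm_num) (by norm_num) (by norm_num) (by norm_num)
    (by norm_num) N

/-- Same instance, sharp form: `k = 2 + 24·13^N` even misses `12·13^N·3 ∣ k-2`, so `(k-2)/3 = 8·13^N` is not a
multiple of `12·13^N` and the cubic character below is the toric character of the typed period at that weight. -/
theorem weightClause_offCharacter_thirteen_three (N : ℕ) :
    ∃ k : ℕ, 2 < k ∧ 2 * (13 - 1) * 13 ^ N ∣ k - 2 ∧ 2 * 3 ∣ k - 2 ∧ ¬ (13 - 1) * 13 ^ N * 3 ∣ k - 2 :=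
  weightClause_offCharacter (p := 13) (hK := 3) (d := 3) (by norm_num) (by norm_num) (by norm_num) (by norm_num)
    (by norm_num) N

/-- **The off-branch toric character at `K = ℚ(√-23)`, `p = 13` is non-trivial** (residue arithmetic):
with `ω² - ω + 6 = 0` the two primes above `13` are `ω ≡ 9` and `ω ≡ 5 (mod 13)`; the class generator
`α = 1 + ω = (3+√-23)/2` (trace `3`, norm `8 = 2³`, `(α) = 𝔞³`) reduces to `10` resp. `6`, and
`α^((13-1)/3) = α⁴ ≢ 1` at both primes, so `c ↦ α_c^((k-2)/3) mod 𝔓` at `k - 2 = 24·13^N·t`, `3 ∤ t`, is a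
non-trivial cubic character of the class group `Pic(𝓞_K) ≅ ℤ/3`. -/
theorem offBranchCharacter_sqrtNeg23_thirteen :
    ((9 : ZMod 13) ^ 2 - 9 + 6 = 0 ∧ (5 : ZMod 13) ^ 2 - 5 + 6 = 0) ∧
    ((1 + 9 : ZMod 13) = 10 ∧ (1 + 5 : ZMod 13) = 6) ∧
    ((10 : ZMod 13) * (3 - 10) = 8 ∧ (6 : ZMod 13) * (3 - 6) = 8) ∧
    ((10 : ZMod 13) ^ 4 ≠ 1 ∧ (6 : ZMod 13) ^ 4 ≠ 1) := by
  decide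

/-- `𝔞 ∣ 2` is non-principal in `ℤ[(1+√-23)/2]`: the norm form `a² + ab + 6b²` does not represent `2`
(so the cubic character above is a genuine CLASS-GROUP character, `h(-23) = 3`). -/
theorem no_norm_two_sqrtNeg23 : ∀ a b : ℤ, a ^ 2 + a * b + 6 * b ^ 2 ≠ 2 := by
  intro a b h
  have hb : b = 0 := by nlinarith [sq_nonneg (2 * a + b), sq_nonneg b]
  subst hb
  have h2 : a ^ 2 = 2 := by linarith
  have ha : a ≤ 1 := by nlinarith
  have ha' : -1 ≤ a := by nlinarith
  interval_cases a <;> simp at h2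

end Summit.BirchSwinnertonDyer.BirchSwinnertonDyer.Theorems.VerticalSelmerBound.Negative
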